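import Literature.AnabelianGeometry.SemiGraphs.ProfiniteHomToAnabPullback
import Literature.AnabelianGeometry.SemiGraphs.TemperedFunctorialityWith
import HarnessLib

/-!
# [SemiAnbd] §2/§3: the §2 morphism and the pull-back comparison for an ARBITRARY family of
# conjugating elements (every-`θ` form of `ProfiniteHomToAnabPullback.lean`, ruling ξ2)

Mochizuki, *Semi-graphs of anabelioids*, Publ. RIMS **42** (2006), Rmk. 2.4.2 p. 26 (the 2-cells
`φ_b` of a morphism of semi-graphs of anabelioids), Prop. 3.6 (iv) p. 39 (pulling back coverings)
[cite: MochizukiSemiAnbd2006, Prop 3.6(iv) p.39].  A §3 morphism `F : 𝒢 ⟶ ℋ` records its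
compatibility with the branch maps only as `∃ g`; a *family of conjugating elements*
`θ : F.ConjugatorFamily` (`TemperedFunctorialityWith.lean`, abc-iut-L3-t10) is a CHOICE of the 2-cells.
Here: the §2 morphism `F.toAnabWith θ : 𝒢.toAnab ⟶ ℋ.toAnab` glued by `θ` (the chosen `F.toAnab` of
`ProfiniteHomToAnab.lean` is the case `θ = chosenConjugators`, `toAnabWith_chosenConjugators`), and the
comparison isomorphisms of `ProfiniteHomToAnabPullback.lean` for every `θ` — on BOTH sides the same `θ`:
`(F.toAnabWith θ).pullbackFunctor ⋙ ofBObj ≅ ofBObj ⋙ F.covPullbackWith θ` by identity maps on fibres,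
its finite / tempered / chart forms.  (For `θ ≠ θ'` the two pull-backs are in general NOT isomorphic —
only under the rigidity of Rmk. 2.4.2 — which is why one `θ` must be threaded through both
presentations.)  Nothing here takes a side on [IUTchIII] Cor. 3.12.
-/

noncomputable section

namespace Literature.AnabelianGeometry.SemiGraphs

open CategoryTheory CategoryTheory.Limits
open Literature.AnabelianGeometry.Anabelioids
open Literature.AlgebraicGeometry.Frobenioids (BCat)
open scoped FintypeCatDiscrete Pointwise

universe u

namespace ProfiniteSemiGraph

variable {𝒢 ℋ : ProfiniteSemiGraph.{u}}

namespace Hom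

variable (F : Hom 𝒢 ℋ) (θ : F.ConjugatorFamily)

/-! ### The §2 morphism glued by an arbitrary family `θ` -/

/-- `(F b)_* ∘ F_e` in the presentation used by `ProfiniteHomToAnab.lean` (edge component at the
presented edge `edgeOf (F b)`) is `F.brComp` of `TemperedFunctorialityProofs.lean`.
[cite: MochizukiSemiAnbd2006, Rmk 2.4.2 p.26] -/
theorem brHom_comp_hE'_apply (b : 𝒢.graph.Branch) (v : 𝒢.graph.Vertex)
    (h : 𝒢.graph.abuts b = some v) (x : 𝒢.Ge (𝒢.graph.edgeOf b)) :
    ((ℋ.brHom (F.base.branchMap b) (F.base.vertexMap v) (F.base.abuts_branchMap b v h)).comp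
        (F.hE' (𝒢.graph.edgeOf b) (ℋ.graph.edgeOf (F.base.branchMap b))
          (F.base.edgeOf_branchMap b).symm)) x = F.brComp b v h x := by
  change ℋ.brHom _ _ _ (F.hE' _ _ (F.base.edgeOf_branchMap b).symm x) =
    ℋ.brHomAt _ _ _ _ (F.base.edgeOf_branchMap b) (F.hE _ x)
  rw [Hom.hE'_apply F _ _ (F.base.edgeOf_branchMap b), brHomAt_apply]

/-- The conjugation identity of `θ` in the shape used by `resIsoOfConj`.
[cite: MochizukiSemiAnbd2006, Rmk 2.4.2 p.26] -/
theorem ConjugatorFamily.spec' (b : 𝒢.graph.Branch) (v : 𝒢.graph.Vertex)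
    (h : 𝒢.graph.abuts b = some v) (x : 𝒢.Ge (𝒢.graph.edgeOf b)) :
    ((F.hV v).comp (𝒢.brHom b v h)) x =
      θ.θ b v h *
        ((ℋ.brHom (F.base.branchMap b) (F.base.vertexMap v) (F.base.abuts_branchMap b v h)).comp
          (F.hE' (𝒢.graph.edgeOf b) (ℋ.graph.edgeOf (F.base.branchMap b))
            (F.base.edgeOf_branchMap b).symm)) x * (θ.θ b v h)⁻¹ := by
  rw [brHom_comp_hE'_apply]
  exact (θ.spec b v h x).symm

/-- **The §2 morphism of `F` glued by the family `θ`**: `φ_v = B(F_v)`, `φ_e = B(F_e)`, `φ_b` = "act by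
`θ_b⁻¹`" (Rmk. 2.4.2: a morphism of semi-graphs of anabelioids carries CHOSEN 2-cells).
[cite: MochizukiSemiAnbd2006, Rmk 2.4.2 p.26] -/
def toAnabWith : SemiGraphOfAnabelioids.Hom 𝒢.toAnab ℋ.toAnab where
  base := F.base
  φV v := bCatMap (F.hV v)
  φE e e' h := bCatMap (F.hE' e e' h)
  φB b v h :=
    (ContAction.resComp FintypeCat.{u} (𝒢.brHom b v h) (F.hV v)).symm ≪≫
      resIsoOfConj _ _ (θ.θ b v h) (ConjugatorFamily.spec' F θ b v h) ≪≫
      ContAction.resComp FintypeCat.{u}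
        (F.hE' (𝒢.graph.edgeOf b) (ℋ.graph.edgeOf (F.base.branchMap b))
          (F.base.edgeOf_branchMap b).symm)
        (ℋ.brHom (F.base.branchMap b) (F.base.vertexMap v) (F.base.abuts_branchMap b v h))

/-- `F.toAnabWith θ` has the same underlying morphism of semi-graphs. [cite: MochizukiSemiAnbd2006, Rmk 2.4.2 p.26] -/
@[simp] theorem toAnabWith_base : (F.toAnabWith θ).base = F.base := rfl

/-- Vertex components: `res (F_v)`. [cite: MochizukiSemiAnbd2006, Rmk 2.4.2 p.26] -/
@[simp] theorem toAnabWith_φV_pullback (v : 𝒢.graph.Vertex) :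
    ((F.toAnabWith θ).φV v).pullback = ContAction.res FintypeCat.{u} (F.hV v) := rfl

/-- Edge components: `res (F_e)`. [cite: MochizukiSemiAnbd2006, Rmk 2.4.2 p.26] -/
@[simp] theorem toAnabWith_φE_pullback (e : 𝒢.graph.Edge) (e' : ℋ.graph.Edge)
    (h : F.base.edgeMap e = e') :
    ((F.toAnabWith θ).φE e e' h).pullback = ContAction.res FintypeCat.{u} (F.hE' e e' h) := rfl

/-- The 2-cells act by `θ_b⁻¹`. [cite: MochizukiSemiAnbd2006, Rmk 2.4.2 p.26] -/
theorem toAnabWith_φB_hom_app_apply (b : 𝒢.graph.Branch) (v : 𝒢.graph.Vertex)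
    (h : 𝒢.graph.abuts b = some v) (X : BCat (ℋ.Gv (F.base.vertexMap v))) (x : X.obj.V) :
    (((F.toAnabWith θ).φB b v h).hom.app X).hom.hom x = ((θ.θ b v h)⁻¹ • x : X.obj.V) := rfl

/-- The inverse 2-cells act by `θ_b`. [cite: MochizukiSemiAnbd2006, Rmk 2.4.2 p.26] -/
theorem toAnabWith_φB_inv_app_apply (b : 𝒢.graph.Branch) (v : 𝒢.graph.Vertex)
    (h : 𝒢.graph.abuts b = some v) (Y : BCat (ℋ.Gv (F.base.vertexMap v))) (x : Y.obj.V) :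
    (((F.toAnabWith θ).φB b v h).inv.app Y).hom.hom x = (θ.θ b v h • x : Y.obj.V) := by
  change ((resIsoOfConj _ _ (θ.θ b v h) (ConjugatorFamily.spec' F θ b v h)).inv.app Y).hom.hom x = _
  exact resIsoOfConj_inv_app_apply _ _ _ _ Y x

/-- **The chosen case**: `F.toAnabWith chosenConjugators = F.toAnab` (the element `conjElt` of
`ProfiniteHomToAnab.lean` IS `conjugator`, `conjElt_eq_conjugator`).
[cite: MochizukiSemiAnbd2006, Rmk 2.4.2 p.26] -/
theorem toAnabWith_chosenConjugators : F.toAnabWith F.chosenConjugators = F.toAnab := by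
  have hφB : ∀ (b : 𝒢.graph.Branch) (v : 𝒢.graph.Vertex) (h : 𝒢.graph.abuts b = some v),
      (F.toAnabWith F.chosenConjugators).φB b v h = F.toAnab.φB b v h := by
    intro b v h
    refine Iso.ext (NatTrans.ext (funext fun X => ?_))
    apply ObjectProperty.hom_ext
    apply Action.Hom.ext
    refine ConcreteCategory.hom_ext _ _ fun x => ?_
    rw [toAnabWith_φB_hom_app_apply,
      show F.chosenConjugators.θ b v h = F.conjElt b v h from (F.conjElt_eq_conjugator b v h).symm]
    rfl
  unfold toAnabWith toAnab
  congr 1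
  funext b v h
  exact hφB b v h

/-! ### The pull-back comparison for the family `θ` -/

/-- The gluing of the covering underlying `(F.toAnabWith θ)^* X` along a branch: transport, the gluing
of `X` along `F b`, then the action of `θ_b` — the formula of `covPullbackWith_glue_apply`.
[cite: MochizukiSemiAnbd2006, Prop 3.6(iv) p.39] -/
theorem ofBObj_toAnabWith_pullback_glue_apply (X : ℋ.toAnab.BObj) (b : 𝒢.graph.Branch)
    (v : 𝒢.graph.Vertex) (h : 𝒢.graph.abuts b = some v)
    (y : ((𝒢.ofBObj.obj ((F.toAnabWith θ).pullbackFunctor.obj X)).SE (𝒢.graph.edgeOf b)).obj.V) :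
    ((𝒢.ofBObj.obj ((F.toAnabWith θ).pullbackFunctor.obj X)).glue b v h).hom.hom.hom y =
      ((ℋ.ofBObj.obj X).SV (F.base.vertexMap v)).obj.ρ (θ.θ b v h)
        (((ℋ.ofBObj.obj X).glue (F.base.branchMap b) (F.base.vertexMap v)
            (F.base.abuts_branchMap b v h)).hom.hom.hom (F.base.edgeOf_branchMap b ▸ y)) := by
  have step : ((𝒢.ofBObj.obj ((F.toAnabWith θ).pullbackFunctor.obj X)).glue b v h).hom.hom.hom y =
      (((F.toAnabWith θ).φB b v h).inv.app (X.S (F.base.vertexMap v))).hom.hom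
        ((X.ψ (F.base.branchMap b) (F.base.vertexMap v) (F.base.abuts_branchMap b v h)).inv.hom.hom
          ((((F.toAnabWith θ).reindexIso (𝒢.graph.edgeOf b) _ _ (F.base.edgeOf_branchMap b).symm
              rfl).inv.app X).hom.hom y)) := rfl
  have hre : ((((F.toAnabWith θ).reindexIso (𝒢.graph.edgeOf b) _ _ (F.base.edgeOf_branchMap b).symm
      rfl).inv.app X).hom.hom y) =
      (F.base.edgeOf_branchMap b ▸ y :
        (X.T (ℋ.graph.edgeOf (F.base.branchMap b))).obj.V) := by
    have gen : ∀ (e : 𝒢.graph.Edge) (f : ℋ.graph.Edge) (p : F.base.edgeMap e = f)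
        (y : (X.T (F.base.edgeMap e)).obj.V),
        (((F.toAnabWith θ).reindexIso e f ((F.toAnabWith θ).base.edgeMap e) p rfl).inv.app X).hom.hom y
          = (p ▸ y : (X.T f).obj.V) := by
      intro e f p y
      subst p
      rfl
    exact gen _ _ (F.base.edgeOf_branchMap b).symm y
  rw [step, hre, toAnabWith_φB_inv_app_apply]
  rfl

/-- **B7c for the family `θ`, functor level**: `(F.toAnabWith θ)^* ⋙ ofBObj ≅ ofBObj ⋙ F^*_θ` by
identity maps on all fibres. [cite: MochizukiSemiAnbd2006, Prop 3.6(iv) p.39] -/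
def toAnabPullbackIsoWith :
    (F.toAnabWith θ).pullbackFunctor ⋙ 𝒢.ofBObj ≅ ℋ.ofBObj ⋙ F.covPullbackWith θ :=
  NatIso.ofComponents
    (fun X => CovObj.isoOfComponents
      (fun v => (temperedAction _).isoMk (Action.mkIso (Iso.refl _) (fun _ => rfl)))
      (fun e => (temperedAction _).isoMk (Action.mkIso (Iso.refl _) (fun _ => rfl)))
      (fun b v h => by
        apply ObjectProperty.hom_ext
        apply Action.Hom.ext
        refine ConcreteCategory.hom_ext _ _ fun y => ?_
        change (((F.covPullbackWith θ).obj (ℋ.ofBObj.obj X)).glue b v h).hom.hom.hom y =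
          ((𝒢.ofBObj.obj ((F.toAnabWith θ).pullbackFunctor.obj X)).glue b v h).hom.hom.hom y
        rw [covPullbackWith_glue_apply, ofBObj_toAnabWith_pullback_glue_apply]))
    (fun {X Y} g => by
      refine CovHom.ext (funext fun v => ?_) (funext fun e => ?_)
      · apply ObjectProperty.hom_ext
        apply Action.Hom.ext
        refine ConcreteCategory.hom_ext _ _ fun y => ?_
        rfl
      · apply ObjectProperty.hom_ext
        apply Action.Hom.ext
        refine ConcreteCategory.hom_ext _ _ fun y => ?_
        rfl)

/-- Identity on vertex fibres. [cite: MochizukiSemiAnbd2006, Prop 3.6(iv) p.39] -/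
@[simp] theorem toAnabPullbackIsoWith_hom_app_fV_apply (X : ℋ.toAnab.BObj) (v : 𝒢.graph.Vertex)
    (x : ((𝒢.ofBObj.obj ((F.toAnabWith θ).pullbackFunctor.obj X)).SV v).obj.V) :
    (((F.toAnabPullbackIsoWith θ).hom.app X).fV v).hom.hom x = x := rfl

/-- Identity on edge fibres. [cite: MochizukiSemiAnbd2006, Prop 3.6(iv) p.39] -/
@[simp] theorem toAnabPullbackIsoWith_hom_app_fE_apply (X : ℋ.toAnab.BObj) (e : 𝒢.graph.Edge)
    (x : ((𝒢.ofBObj.obj ((F.toAnabWith θ).pullbackFunctor.obj X)).SE e).obj.V) :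
    (((F.toAnabPullbackIsoWith θ).hom.app X).fE e).hom.hom x = x := rfl

/-- Identity on vertex fibres (inverse). [cite: MochizukiSemiAnbd2006, Prop 3.6(iv) p.39] -/
@[simp] theorem toAnabPullbackIsoWith_inv_app_fV_apply (X : ℋ.toAnab.BObj) (v : 𝒢.graph.Vertex)
    (x : (((F.covPullbackWith θ).obj (ℋ.ofBObj.obj X)).SV v).obj.V) :
    (((F.toAnabPullbackIsoWith θ).inv.app X).fV v).hom.hom x = x := rfl

/-- Identity on edge fibres (inverse). [cite: MochizukiSemiAnbd2006, Prop 3.6(iv) p.39] -/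
@[simp] theorem toAnabPullbackIsoWith_inv_app_fE_apply (X : ℋ.toAnab.BObj) (e : 𝒢.graph.Edge)
    (x : (((F.covPullbackWith θ).obj (ℋ.ofBObj.obj X)).SE e).obj.V) :
    (((F.toAnabPullbackIsoWith θ).inv.app X).fE e).hom.hom x = x := rfl

/-- `F^*_θ` on finite objects. [cite: MochizukiSemiAnbd2006, Prop 3.6(iv) p.39] -/
def bfinPullbackWith : BFinCat ℋ ⥤ BFinCat 𝒢 :=
  ObjectProperty.lift _ (ObjectProperty.ι _ ⋙ F.covPullbackWith θ)
    fun S => F.isFinite_covPullbackWith θ S.property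

/-- `F^*_θ` on `BFinCat` lies over `F^*_θ` on `B^cov` (definitional). [cite: MochizukiSemiAnbd2006, Prop 3.6(iv) p.39] -/
theorem bfinPullbackWith_comp_ι :
    F.bfinPullbackWith θ ⋙ ObjectProperty.ι _ = ObjectProperty.ι _ ⋙ F.covPullbackWith θ := rfl

/-- The chosen case (definitional). [cite: MochizukiSemiAnbd2006, Prop 3.6(iv) p.39] -/
theorem bfinPullback_eq_bfinPullbackWith : F.bfinPullback = F.bfinPullbackWith F.chosenConjugators :=
  rfl

/-- **B7c for `θ`, finite-object level.** [cite: MochizukiSemiAnbd2006, Prop 3.6(iv) p.39] -/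
def toAnabPullbackIsoFinWith :
    (F.toAnabWith θ).pullbackFunctor ⋙ 𝒢.ofBObjFin ≅ ℋ.ofBObjFin ⋙ F.bfinPullbackWith θ :=
  NatIso.ofComponents
    (fun X => (ObjectProperty.fullyFaithfulι _).preimageIso ((F.toAnabPullbackIsoWith θ).app X))
    (fun g => ObjectProperty.hom_ext _ ((F.toAnabPullbackIsoWith θ).hom.naturality g))

/-- **B7c for `θ`, chart-shaped through `equivBFin`.** [cite: MochizukiSemiAnbd2006, Prop 3.6(iv) p.39] -/
def bfinPullbackIsoWith :
    F.bfinPullbackWith θ ≅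
      ℋ.equivBFin.inverse ⋙ (F.toAnabWith θ).pullbackFunctor ⋙ 𝒢.equivBFin.functor :=
  (Functor.leftUnitor _).symm ≪≫
    Functor.isoWhiskerRight ℋ.equivBFin.counitIso.symm (F.bfinPullbackWith θ) ≪≫
    Functor.associator _ _ _ ≪≫
    Functor.isoWhiskerLeft ℋ.equivBFin.inverse (F.toAnabPullbackIsoFinWith θ).symm

/-- **B7c for `θ`, tempered level.** [cite: MochizukiSemiAnbd2006, Prop 3.6(iv) p.39] -/
def toAnabPullbackIsoTempWith (h𝒢 : ∀ S : CovObj 𝒢, S.IsFinite → S.IsTempered)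
    (hℋ : ∀ S : CovObj ℋ, S.IsFinite → S.IsTempered) :
    (F.toAnabWith θ).pullbackFunctor ⋙ 𝒢.ofBObjTemp h𝒢 ≅ ℋ.ofBObjTemp hℋ ⋙ F.btempPullbackWith θ :=
  NatIso.ofComponents
    (fun X => (ObjectProperty.fullyFaithfulι _).preimageIso ((F.toAnabPullbackIsoWith θ).app X))
    (fun g => ObjectProperty.hom_ext _ ((F.toAnabPullbackIsoWith θ).hom.naturality g))

variable {F θ} in
/-- **B7c for `θ` at the level of charts**: if `B^temp(φ) ≅ F.chartPullbackWith θ c𝒢 cℋ` (the body of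
`InducesWith θ`, ruling ξ2), then `ofBObjTemp ⋙ c_ℋ ⋙ B^temp(φ) ≅ (F.toAnabWith θ)^* ⋙ ofBObjTemp ⋙ c_𝒢`.
[cite: MochizukiSemiAnbd2006, Prop 3.6(iv) p.39] -/
theorem chart_res_iso_of_chartPullbackWith_iso {c𝒢 : TemperedPiChart 𝒢} {cℋ : TemperedPiChart ℋ}
    {φ : c𝒢.G →ₜ* cℋ.G} (hF : Nonempty (F.chartPullbackWith θ c𝒢 cℋ ≅ BTemp.res φ))
    (h𝒢 : ∀ S : CovObj 𝒢, S.IsFinite → S.IsTempered)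
    (hℋ : ∀ S : CovObj ℋ, S.IsFinite → S.IsTempered) :
    Nonempty (ℋ.ofBObjTemp hℋ ⋙ cℋ.equiv.functor ⋙ BTemp.res φ ≅
      (F.toAnabWith θ).pullbackFunctor ⋙ 𝒢.ofBObjTemp h𝒢 ⋙ c𝒢.equiv.functor) := by
  obtain ⟨i⟩ := hF
  exact ⟨Functor.isoWhiskerLeft _ (Functor.isoWhiskerLeft _ i.symm) ≪≫
    Functor.isoWhiskerLeft _ (Functor.associator _ _ _).symm ≪≫
    Functor.isoWhiskerLeft _ (Functor.isoWhiskerRight cℋ.equiv.unitIso.symm _) ≪≫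
    Functor.isoWhiskerLeft _ (Functor.leftUnitor _) ≪≫
    (Functor.associator _ _ _).symm ≪≫
    Functor.isoWhiskerRight (F.toAnabPullbackIsoTempWith θ h𝒢 hℋ).symm _ ≪≫
    Functor.associator _ _ _⟩

end Hom

end ProfiniteSemiGraph

end Literature.AnabelianGeometry.SemiGraphs

end
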